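import Mathlib

/-!
# Isogeny alphabet — the 𝔽₂-shadow of LEMMA SPLIT (L4) (cell pub-hsemireg, seat isogeny-1 g5; evidence only)

Object level (memo `SPEC-ISOGENY-ALPHABET-isogeny1-g5.md` §1, critic idea-crit-hsem-3 l.9245): for a `(1+i)`-isogeny
letter `D_* L_X` on `E⁸` (`E = ℂ/ℤ[i]`) the group `G' = ker D ∩ K(L_X)` that decides Mukai-simplicity is computed factor by
factor from `X_f mod (1+i)`.  Under `ℤ[i] → 𝔽₂`, `u + iv ↦ u + v`, the LINE-`h` block `[[a, x+iy],[x-iy, a]]`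
(`a + |x| + |y| = h`) becomes `[[ā, s̄],[s̄, ā]]` with `s = x + y`, whose determinant is `(ā + s̄)² = h̄²`.
Hence: `h` odd ⇒ every block is invertible over `𝔽₂` (so `G' = 0`: every `(1+i)`-letter is simple);
`h` even ⇒ every block is singular, with the explicit kernel vector `(1,1)`.

This file is ONLY that finite-field arithmetic (the "typed shadow"); the identification with `G'`, Mukai's theorem and
everything about sheaves stay pencil.  Nothing here is a step toward HC / HC_CM / HC_AV / №4 / 26512 / 18881 / H2.
-/

namespace Summit.Ventures.HSemireg.IsogenyParityShadow

open Matrix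

/-- The reduction mod `(1+i)` of a LINE-`h` block: `[[a, s],[s, a]]` over `𝔽₂`. -/
def redBlock (a s : ZMod 2) : Matrix (Fin 2) (Fin 2) (ZMod 2) := !![a, s; s, a]

theorem det_redBlock (a s : ZMod 2) : (redBlock a s).det = (a + s) ^ 2 := by
  unfold redBlock
  rw [Matrix.det_fin_two_of]
  fin_cases a <;> fin_cases s <;> decide

/-- Parity of `|x|` is the parity of `x`. -/
theorem cast_abs_eq (x : ℤ) : ((|x| : ℤ) : ZMod 2) = (x : ZMod 2) := by
  rcases abs_choice x with h | h
  · rw [h]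
  · rw [h, Int.cast_neg, ZMod.neg_eq_self_mod_two]

/-- On LINE-`h` (`a + |x| + |y| = h`) the reduced block has determinant `h̄ ²` (`= h̄` in `𝔽₂`). -/
theorem det_redBlock_line (a x y h : ℤ) (hline : a + |x| + |y| = h) :
    (redBlock (a : ZMod 2) ((x + y : ℤ) : ZMod 2)).det = ((h : ℤ) : ZMod 2) ^ 2 := by
  rw [det_redBlock, ← hline]
  push_cast
  rw [cast_abs_eq x, cast_abs_eq y]
  ring

/-- `h` odd: every reduced LINE-`h` block is invertible over `𝔽₂` (determinant `1`). -/
theorem det_redBlock_line_of_odd (a x y h : ℤ) (hline : a + |x| + |y| = h) (hodd : Odd h) :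
    (redBlock (a : ZMod 2) ((x + y : ℤ) : ZMod 2)).det = 1 := by
  rw [det_redBlock_line a x y h hline, (ZMod.intCast_eq_one_iff_odd).2 hodd, one_pow]

/-- `h` odd: the reduced block has trivial kernel — the shadow of «`G' = 0`, every `(1+i)`-letter on an odd line is simple». -/
theorem mulVec_eq_zero_iff_of_odd (a x y h : ℤ) (hline : a + |x| + |y| = h) (hodd : Odd h)
    (v : Fin 2 → ZMod 2) :
    (redBlock (a : ZMod 2) ((x + y : ℤ) : ZMod 2)).mulVec v = 0 ↔ v = 0 := by
  have hdet : (redBlock (a : ZMod 2) ((x + y : ℤ) : ZMod 2)).det ≠ 0 := by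
    rw [det_redBlock_line_of_odd a x y h hline hodd]; exact one_ne_zero
  constructor
  · intro hv
    exact Matrix.eq_zero_of_mulVec_eq_zero hdet hv
  · rintro rfl; simp

/-- `h` even: every reduced LINE-`h` block is singular (determinant `0`) … -/
theorem det_redBlock_line_of_even (a x y h : ℤ) (hline : a + |x| + |y| = h) (heven : Even h) :
    (redBlock (a : ZMod 2) ((x + y : ℤ) : ZMod 2)).det = 0 := by
  rw [det_redBlock_line a x y h hline, (ZMod.intCast_eq_zero_iff_even).2 heven, zero_pow two_ne_zero]

/-- … with the explicit kernel vector `(1,1)`: on an even line `ā = s̄`, so both rows of `[[ā,s̄],[s̄,ā]]` sum to `ā + s̄ = h̄ = 0`. -/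
theorem mulVec_one_one_eq_zero_of_even (a x y h : ℤ) (hline : a + |x| + |y| = h) (heven : Even h) :
    (redBlock (a : ZMod 2) ((x + y : ℤ) : ZMod 2)).mulVec ![1, 1] = 0 := by
  have hsum : (a : ZMod 2) + ((x : ZMod 2) + (y : ZMod 2)) = 0 := by
    have : ((h : ℤ) : ZMod 2) = 0 := (ZMod.intCast_eq_zero_iff_even).2 heven
    rw [← this, ← hline]; push_cast; rw [cast_abs_eq x, cast_abs_eq y]; ring
  ext i
  fin_cases i <;> simp [redBlock, Matrix.mulVec, dotProduct, Fin.sum_univ_two] <;>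
    first | exact hsum | (rw [add_comm]; exact hsum)

/-! ## The reduction `ℤ[i] → 𝔽₂` itself and the block it produces -/

open Zsqrtd

/-- `u + iv ↦ ū + v̄`: the quotient map `ℤ[i] → ℤ[i]/(1+i) = 𝔽₂` (`i ↦ 1`, legitimate since `1·1 = -1` in `𝔽₂`). -/
noncomputable def redHom : GaussianInt →+* ZMod 2 := Zsqrtd.lift ⟨1, by decide⟩

theorem redHom_apply (u v : ℤ) : redHom ⟨u, v⟩ = (u : ZMod 2) + (v : ZMod 2) := by
  simp [redHom, Zsqrtd.lift]

/-- `1 + i ↦ 0`: the kernel contains (hence equals, both sides having index 2) the prime `(1+i)`. -/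
theorem redHom_one_add_i : redHom ⟨1, 1⟩ = 0 := by
  rw [redHom_apply]; decide

/-- complex conjugation is invisible mod `(1+i)`. -/
theorem redHom_conj (u v : ℤ) : redHom ⟨u, -v⟩ = redHom ⟨u, v⟩ := by
  rw [redHom_apply, redHom_apply, Int.cast_neg, ZMod.neg_eq_self_mod_two]

/-- The hermitian LINE block `X = [[a, x+iy],[x-iy, a]]` over `ℤ[i]`. -/
def lineBlock (a x y : ℤ) : Matrix (Fin 2) (Fin 2) GaussianInt := !![(a : GaussianInt), ⟨x, y⟩; ⟨x, -y⟩, (a : GaussianInt)]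

/-- Its reduction mod `(1+i)` is the `𝔽₂`-block `[[ā, s̄],[s̄, ā]]`, `s = x + y`, of the first part of the file. -/
theorem map_lineBlock (a x y : ℤ) :
    (lineBlock a x y).map redHom = redBlock (a : ZMod 2) ((x + y : ℤ) : ZMod 2) := by
  ext i j
  fin_cases i <;> fin_cases j <;>
    simp [lineBlock, redBlock, Matrix.map_apply, redHom_apply, map_intCast, Int.cast_add, ZMod.neg_eq_self_mod_two]

/-- Packaging: on an odd line the reduced block of every factor is invertible; on an even line it kills `(1,1)`. -/
theorem lineBlock_parity (a x y h : ℤ) (hline : a + |x| + |y| = h) :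
    (Odd h → ((lineBlock a x y).map redHom).det = 1) ∧ (Even h → ((lineBlock a x y).map redHom).mulVec ![1, 1] = 0) := by
  rw [map_lineBlock]
  exact ⟨det_redBlock_line_of_odd a x y h hline, mulVec_one_one_eq_zero_of_even a x y h hline⟩

end Summit.Ventures.HSemireg.IsogenyParityShadow
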